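import Mathlib
import Summits.ValiantsHypothesis.ValiantsHypothesis.Theorems.LacunarySymmetroidMatrixDescartesStubPerturbGeneric
import Summits.ValiantsHypothesis.ValiantsHypothesis.Theorems.MatrixDescartes.Negative.MatrixDescartesWitness24

/-!
# `MatrixDescartes` (stmt-ValiantsHypothesis-18050), line «definite-pair-fold-law» — stub `stub_perturb`

The ideator line `Cruxes/MatrixDescartes/Lines/definite_pair_fold_law.lean` (val-idea-2 g2, 2026-08-28) registers,
among its five `sorry`s, the format-wide perturbation step

  `stub_perturb : ∀ m K B : ℕ, AltLawAt m K B → PosRootLawAt m K (2 * B)`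

(«if every symmetric `(m,K)` pencil has at most `B` strict sign alternations on `(0,∞)` then every symmetric
`(m,K)` pencil has at most `2B` distinct positive roots»).  Its line card records that this «is the strategist's
`PerturbToAlternation` (sign-split line) in format-wide form».  That statement is a THEOREM of the tree since
2026-08-28: `LacunarySymmetroidMatrixDescartes.Perturb.perturbToAlternation`
(`Theorems/LacunarySymmetroidMatrixDescartesStubPerturbGeneric.lean`; rank-one perturbation of one coefficient in a
generic direction, Jacobi's formula, odd roots alternate / even roots split for one sign).  This file is the
ADAPTER: `stub_perturb` below has exactly the line's statement with `AltLawAt`, `Alternates`, `pencilDet` unfolded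
(`PosRootLawAt` is the tree's `Theorems.MatrixDescartes.Negative.PosRootLawAt`, which the line imports), so the
skeleton's `sorry` closes by `exact FoldLaw.stub_perturb`; the only work is the exchange `∃ τ ↔ ∀ τ` and the binder
order `(m, K)` versus `(K, m)`.

Helper mode (`--supports stmt-ValiantsHypothesis-18050 --as helper`): the line is not registered on the item.
Honest framing: a bookkeeping stub of a LAW line; the law `stub_foldLaw`, Conjecture B (`KPlusLogSqLaw`), the crux
`MatrixDescartes` and VP ≠ VNP are OPEN and NOT moved by this file.
-/

set_option linter.dupNamespace false

namespace Summit.ValiantsHypothesis.ValiantsHypothesis.Theorems.LacunarySymmetroidMatrixDescartes.FoldLaw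

open Polynomial Matrix
open scoped BigOperators
open Summit.ValiantsHypothesis.ValiantsHypothesis.Theorems.MatrixDescartes.Negative (PosRootLawAt)

/-- **`stub_perturb` of line «definite-pair-fold-law»** (statement = the line's
`∀ m K B : ℕ, AltLawAt m K B → PosRootLawAt m K (2 * B)` with `AltLawAt` / `Alternates` / `pencilDet` unfolded):
an alternation budget `B` for all symmetric `(m,K)` pencils gives the distinct-positive-root budget `2B` for all
symmetric `(m,K)` pencils.  Proof: `Perturb.perturbToAlternation`. -/
theorem stub_perturb :
    ∀ m K B : ℕ,
      (∀ (d : Fin K → ℕ) (S : Fin K → Matrix (Fin m) (Fin m) ℝ), (∀ l, (S l).IsSymm) →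
        ∀ N : ℕ,
          (∃ τ : Fin (N + 1) → ℝ, StrictMono τ ∧ (∀ i, 0 < τ i) ∧
            ∀ i : Fin N,
              (∑ l, (X : ℝ[X]) ^ d l • (S l).map Polynomial.C).det.eval (τ i.castSucc) *
                (∑ l, (X : ℝ[X]) ^ d l • (S l).map Polynomial.C).det.eval (τ i.succ) < 0) →
          N ≤ B) →
      PosRootLawAt m K (2 * B) := by
  intro m K B hAlt d S hS
  exact Perturb.perturbToAlternation K m d B (fun S' hS' N τ hτ => hAlt d S' hS' N ⟨τ, hτ⟩) S hS

end Summit.ValiantsHypothesis.ValiantsHypothesis.Theorems.LacunarySymmetroidMatrixDescartes.FoldLaw
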